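import Mathlib
import Literature.NumberTheory.Automorphic.CompactCoreCentralizerUnitary   -- ★ `centralizer_prod_singleton` (reused, dedup)
import HarnessLib

/-!
# F0 · P3c · line LH6 «StCharTS» — «CARTAN-ELL-PROD★»: the elliptic Cartan representatives of a product `A × B` with `B` COMPACT ABELIAN
# are the `T × B` for the elliptic Cartan representatives `T` of `A` (the three clauses of the (P5) «CARTAN-ELL-H» ∃-fact, transported)

Cell `pub/hodgecm-mathlib`, FLOOR 0, crux H413 = stmt-HodgeConjecture-24833, SUPPORTS-ONLY lane
(`--kind proof --supports stmt-HodgeConjecture-24833 --as helper`), prover seat F0P2-p01 (g22), 2026-09-02.  THEOREMS ONLY, GENERIC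
(two topological groups `A`, `B`; no `U(3)`), Mathlib + ONE ★ Literature import (`CompactCoreCentralizerUnitary`, for `centralizer_prod_singleton`) + HarnessLib.  Touches no registry and no served Line; count-neutral.

WHY.  The endoscopic group of the LH6 organ (S-𝔇) at a finite place is the PRODUCT `H_v = U(Φ₂)(L⁺_v) × U(Φ₁)(L⁺_v)` whose second factor
is a COMPACT ABELIAN group (the norm-one torus of `L_w ∕ L⁺_v`).  The rung-0 assembler takes the (P5) «CARTAN-ELL-H» ∃-fact (★ p851472
`F0P3cStCharTSHFields.cartanH_pins_of_cartanEllH`, hypothesis `hCartEllH`; MAP-DATUM-ROAD v5 §3 row `cartanH μTH`: «RUNG0 HYPOTHESIS (print §3.6∕§12.5)»)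
— a finite set `SH` of COMPACT Cartan subgroups `Z_H(γ₀)`, `γ₀` `G`-regular, COMPLETE up to `H_v`-conjugacy among the compact `Z_H(γ₀)` and
pairwise non-conjugate — as ONE hypothesis, while the in-house road CARTAN-FIN (N1) (F0P3a-p03 (g24), 13:58:08Z) produces such sets for the
unitary groups `U(Φ_N)(L⁺_v)` THEMSELVES (any rank `N`).  This file is the bridge: the three clauses for `A × B` follow from the three clauses
for `A`, for ANY regularity predicates `RegA` on `A` and `Reg` on `A × B` with `Reg (a, b) → RegA a` (★ `isRegularElt_fst_of_isLocalGRegular` at the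
organ) and `RegA a → ∃ b, Reg (a, b)` (a `G`-regular completion of a regular `a ∈ U(Φ₂)` exists: `U(Φ₁)(L⁺_v)` is infinite), because
`Z_{A×B}((a, b)) = Z_A(a) × B` (§1), conjugation by `(x, y)` acts on `T × B` through `x` alone (§2), and `T × B` is compact iff `T` is (§3).

* §1 (★ `Literature.NumberTheory.Automorphic.centralizer_prod_singleton`: `Z_{A×B}((a,b)) = Z_A(a) ×ˢ Z_B(b)`, reused), `centralizer_singleton_eq_top_of_comm`, `centralizer_singleton_prod_eq_prod_top`.
* §2 `map_conj_eq_of_prod_top` (`Ad(x,y)(T × B) = Ad(x)(T) × B`), `prod_top_injective`, `centralizer_singleton_conj_eq_map` (`Z(xγx⁻¹) = Ad(x) Z(γ)`).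
* §3 `isCompact_coe_prod_top_iff` (`T × B` compact iff `T` compact, `B` compact).
* §4 THE TRANSPORT `exists_cartanEll_prod_of_cartanEll`: the three clauses (compact `Z(γ₀)` representatives with `Reg γ₀` ∕ completeness ∕ pairwise
  non-conjugacy) for `A × B` from the three clauses for `A`; and `exists_cartanEll_prod_of_cartanEll_haar`: the same with a Haar PROBABILITY measure
  on every representative (Mathlib `haarMeasure ⊤` on the compact subtype) — the (P5) text's shape `∃ SH μTHf, …` token for token at abstract
  `A`, `B`, `Reg`.
* §5 NORMAL FORM `exists_cartanEll_of_finite_classes`: from the CARTAN-FIN road's TWO-clause head shape («finitely many conjugacy classes of Cartan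
  subgroups `Z(γ)`, `P γ`»: `∃ S` finite, members `Z(γ₀)` with `P γ₀`, every `Z(γ)` is `Ad(u) T`, `T ∈ S`) to the THREE-clause (P5) shape on the
  COMPACT ones with pairwise NON-conjugate representatives (one per class by `Classical.epsilon`; conjugacy of subgroups is an equivalence relation,
  `isConjSubgroup_refl ∕ symm ∕ trans`, `mem_map_conj_iff`, `isCompact_coe_map_conj_iff`).  So the `A`-side hypothesis of §4 is exactly what the road delivers.
The instantiation at `H_v` (`A := U(Φ₂)(L⁺_v)`, `B := U(Φ₁)(L⁺_v)`, `Reg := IsLocalGRegular L v`, `RegA a := IsRegularElt a`) is a separate file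
(it needs the organ's carriers); there the residual inputs are EXACTLY: the rank-2 CARTAN-FIN clauses for `U(Φ₂)(L⁺_v)`, compactness and
commutativity of `U(Φ₁)(L⁺_v)`, and the `G`-regular completion sentence.

HONEST LABEL: HC_CM is proved only modulo the 7 printed citations (2 remaining named inputs: hLiu418 = stmt-HodgeConjecture-24832,
h413 = stmt-HodgeConjecture-24833) until rung 0 closes; this file is pure group theory ∕ topology and pays nothing by itself.

## References
* [Rogawski1990] J. D. Rogawski, *Automorphic Representations of Unitary Groups in Three Variables*, Ann. of Math. Stud. 123 (1990):
  §3.6 pp. 28–31 (Cartan subgroups of unitary groups and of `H = U(2) × U(1)`), §4.3 p. 42 (`G`-regular elements of `H`),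
  §12.5 p. 184 (the elliptic tori of `H` in the Weyl integration formula, normalised measures).
* [Folland1995] G. B. Folland, *A Course in Abstract Harmonic Analysis* (1995), §2.2 (Haar measure on a compact group).
-/

set_option autoImplicit false
-- the mandated namespace repeats `HodgeConjecture.HodgeConjecture`, as in every `Theorems/*.lean` of this sub-problem
set_option linter.dupNamespace false

noncomputable section

namespace Summit.HodgeConjecture.HodgeConjecture.Cruxes.H413.F0P3cStCharTSCartanEllProd

open MeasureTheory MeasureTheory.Measure TopologicalSpace Set

section Algebra

variable {A B : Type*} [Group A] [Group B]

/-! ## §1 Centralisers in a product -/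

/-- In a commutative group every centraliser is everything. [folklore] -/
theorem centralizer_singleton_eq_top_of_comm (hB : ∀ b₁ b₂ : B, b₁ * b₂ = b₂ * b₁) (b : B) :
    Subgroup.centralizer ({b} : Set B) = ⊤ := by
  ext y
  simp only [Subgroup.mem_centralizer_singleton_iff, Subgroup.mem_top, iff_true]
  exact hB y b

/-- `Z_{A×B}((a, b)) = Z_A(a) × B` when `B` is commutative. [folklore] [cite: Rogawski1990, §3.6 pp. 28–31] -/
theorem centralizer_singleton_prod_eq_prod_top (hB : ∀ b₁ b₂ : B, b₁ * b₂ = b₂ * b₁) (a : A) (b : B) :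
    Subgroup.centralizer ({(a, b)} : Set (A × B)) = (Subgroup.centralizer ({a} : Set A)).prod (⊤ : Subgroup B) := by
  rw [Literature.NumberTheory.Automorphic.centralizer_prod_singleton, centralizer_singleton_eq_top_of_comm hB]

/-! ## §2 Conjugation of `T × B` and of centralisers -/

/-- `Ad(x, y)(T × B) = Ad(x)(T) × B`: conjugating a «full in `B`» subgroup of `A × B` only moves the `A`-factor. [folklore] -/
theorem map_conj_prod_top (x : A) (y : B) (T : Subgroup A) :
    (T.prod (⊤ : Subgroup B)).map (MulAut.conj (x, y)).toMonoidHom = (T.map (MulAut.conj x).toMonoidHom).prod ⊤ := by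
  ext ⟨p, q⟩
  simp only [Subgroup.mem_map, Subgroup.mem_prod, Subgroup.mem_top, and_true, MulEquiv.coe_toMonoidHom, MulAut.conj_apply,
    Prod.exists, Prod.inv_mk, Prod.mk_mul_mk, Prod.mk.injEq]
  constructor
  · rintro ⟨p', q', hp', hp, -⟩
    exact ⟨p', hp', hp⟩
  · rintro ⟨p', hp', hp⟩
    exact ⟨p', y⁻¹ * q * y, hp', hp, by group⟩

/-- If SOME conjugate of `T × B` in `A × B` is `T′ × B`, then some conjugate of `T` in `A` is `T′`. [folklore] -/
theorem exists_map_conj_eq_of_prod_top {T T' : Subgroup A}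
    (h : ∃ z : A × B, (T.prod (⊤ : Subgroup B)).map (MulAut.conj z).toMonoidHom = T'.prod ⊤) :
    ∃ x : A, T.map (MulAut.conj x).toMonoidHom = T' := by
  obtain ⟨⟨x, y⟩, hz⟩ := h
  refine ⟨x, ?_⟩
  rw [map_conj_prod_top] at hz
  ext p
  have := congrArg (fun S : Subgroup (A × B) => ((p, (1 : B)) ∈ S)) hz
  simpa only [Subgroup.mem_prod, Subgroup.mem_top, and_true, eq_iff_iff] using this

/-- `T ↦ T × B` is injective on subgroups. [folklore] -/
theorem prod_top_injective {T T' : Subgroup A} (h : T.prod (⊤ : Subgroup B) = T'.prod ⊤) : T = T' := by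
  ext p
  have := congrArg (fun S : Subgroup (A × B) => ((p, (1 : B)) ∈ S)) h
  simpa only [Subgroup.mem_prod, Subgroup.mem_top, and_true, eq_iff_iff] using this

/-- `Z(x γ x⁻¹) = Ad(x) Z(γ)`. [folklore] -/
theorem centralizer_singleton_conj_eq_map {G : Type*} [Group G] (x γ : G) :
    Subgroup.centralizer ({x * γ * x⁻¹} : Set G) = (Subgroup.centralizer ({γ} : Set G)).map (MulAut.conj x).toMonoidHom := by
  ext k
  simp only [Subgroup.mem_centralizer_singleton_iff, Subgroup.mem_map, MulEquiv.coe_toMonoidHom, MulAut.conj_apply]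
  constructor
  · intro hk
    refine ⟨x⁻¹ * k * x, ?_, by group⟩
    have h1 : (x⁻¹ * k * x) * γ = x⁻¹ * (k * (x * γ * x⁻¹)) * x := by group
    have h2 : γ * (x⁻¹ * k * x) = x⁻¹ * ((x * γ * x⁻¹) * k) * x := by group
    rw [h1, h2, hk]
  · rintro ⟨k', hk', rfl⟩
    have h1 : x * k' * x⁻¹ * (x * γ * x⁻¹) = x * (k' * γ) * x⁻¹ := by group
    have h2 : x * γ * x⁻¹ * (x * k' * x⁻¹) = x * (γ * k') * x⁻¹ := by group
    rw [h1, h2, hk']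

/-- In `A × B` with `B` commutative, `Z((x,y) (a,b) (x,y)⁻¹) = Z_A(x a x⁻¹) × B`. [folklore] -/
theorem centralizer_singleton_conj_prod_eq (hB : ∀ b₁ b₂ : B, b₁ * b₂ = b₂ * b₁) (x a : A) (y b : B) :
    Subgroup.centralizer ({(x, y) * (a, b) * (x, y)⁻¹} : Set (A × B)) =
      (Subgroup.centralizer ({x * a * x⁻¹} : Set A)).prod (⊤ : Subgroup B) := by
  rw [Prod.inv_mk, Prod.mk_mul_mk, Prod.mk_mul_mk, centralizer_singleton_prod_eq_prod_top hB]

end Algebra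

section Topology

variable {A B : Type*} [Group A] [Group B] [TopologicalSpace A] [TopologicalSpace B]

/-! ## §3 Compactness of `T × B` -/

omit [TopologicalSpace A] [TopologicalSpace B] in
/-- The carrier of `T × ⊤` is `T ×ˢ univ`. [folklore] -/
theorem coe_prod_top (T : Subgroup A) : ((T.prod (⊤ : Subgroup B) : Subgroup (A × B)) : Set (A × B)) = (T : Set A) ×ˢ (univ : Set B) := by
  rw [Subgroup.coe_prod, Subgroup.coe_top]

/-- `T × B` is compact iff `T` is, for `B` compact. [folklore] -/
theorem isCompact_coe_prod_top_iff [CompactSpace B] (T : Subgroup A) :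
    IsCompact ((T.prod (⊤ : Subgroup B) : Subgroup (A × B)) : Set (A × B)) ↔ IsCompact (T : Set A) := by
  rw [coe_prod_top]
  constructor
  · intro h
    have : (T : Set A) = Prod.fst '' ((T : Set A) ×ˢ (univ : Set B)) := by
      rw [Set.fst_image_prod _ univ_nonempty]
    rw [this]
    exact h.image continuous_fst
  · intro h
    exact h.prod isCompact_univ

/-! ## §4 The transport of the three clauses -/

/-- **CARTAN-ELL-PROD (measure-free).**  Let `B` be a compact commutative group, `RegA`, `Reg` regularity predicates on `A`, `A × B` with
`Reg γ → RegA γ.1` and `RegA a → ∃ b, Reg (a, b)`.  If `A` has a finite set `SA` of COMPACT Cartan subgroups `Z_A(a₀)` (`RegA a₀`) that is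
complete up to `A`-conjugacy among the compact `Z_A(a₀)`, `RegA a₀`, and pairwise non-conjugate, then `SH := {T × B : T ∈ SA}` is such a set
for `A × B` and `Reg`: every member is a compact `Z_{A×B}(γ₀)` with `Reg γ₀`; every compact `Z_{A×B}(γ₀)`, `Reg γ₀`, is conjugate INTO
`SH` (in the form `Z(z γ₀ z⁻¹) = T`); distinct members are not conjugate. [cite: Rogawski1990, §3.6 pp. 28–31; §12.5 p. 184] -/
theorem exists_cartanEll_prod_of_cartanEll [CompactSpace B] (hB : ∀ b₁ b₂ : B, b₁ * b₂ = b₂ * b₁)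
    {RegA : A → Prop} {Reg : A × B → Prop} (hReg : ∀ γ : A × B, Reg γ → RegA γ.1) (hfill : ∀ a : A, RegA a → ∃ b : B, Reg (a, b))
    (hA : ∃ SA : Finset (Subgroup A),
      (∀ T ∈ SA, IsCompact (T : Set A) ∧ ∃ a₀ : A, RegA a₀ ∧ T = Subgroup.centralizer ({a₀} : Set A)) ∧
      (∀ a₀ : A, RegA a₀ → IsCompact ((Subgroup.centralizer ({a₀} : Set A) : Subgroup A) : Set A) →
        ∃ T ∈ SA, ∃ x : A, Subgroup.centralizer ({x * a₀ * x⁻¹} : Set A) = T) ∧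
      (∀ T ∈ SA, ∀ T' ∈ SA, (∃ x : A, T.map (MulAut.conj x).toMonoidHom = T') → T = T')) :
    ∃ SH : Finset (Subgroup (A × B)),
      (∀ T ∈ SH, IsCompact (T : Set (A × B)) ∧ ∃ γ₀ : A × B, Reg γ₀ ∧ T = Subgroup.centralizer ({γ₀} : Set (A × B))) ∧
      (∀ γ₀ : A × B, Reg γ₀ → IsCompact ((Subgroup.centralizer ({γ₀} : Set (A × B)) : Subgroup (A × B)) : Set (A × B)) →
        ∃ T ∈ SH, ∃ z : A × B, Subgroup.centralizer ({z * γ₀ * z⁻¹} : Set (A × B)) = T) ∧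
      (∀ T ∈ SH, ∀ T' ∈ SH, (∃ z : A × B, T.map (MulAut.conj z).toMonoidHom = T') → T = T') := by
  classical
  obtain ⟨SA, h1, h2, h3⟩ := hA
  refine ⟨SA.image fun T => T.prod (⊤ : Subgroup B), ?_, ?_, ?_⟩
  · intro T hT
    obtain ⟨TA, hTA, rfl⟩ := Finset.mem_image.mp hT
    obtain ⟨hc, a₀, ha₀, rfl⟩ := h1 TA hTA
    obtain ⟨b₀, hb₀⟩ := hfill a₀ ha₀
    exact ⟨(isCompact_coe_prod_top_iff _).mpr hc, (a₀, b₀), hb₀, (centralizer_singleton_prod_eq_prod_top hB a₀ b₀).symm⟩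
  · rintro ⟨a₀, b₀⟩ hγ hc
    rw [centralizer_singleton_prod_eq_prod_top hB, isCompact_coe_prod_top_iff] at hc
    obtain ⟨T, hT, x, hx⟩ := h2 a₀ (hReg _ hγ) hc
    refine ⟨T.prod ⊤, Finset.mem_image.mpr ⟨T, hT, rfl⟩, (x, 1), ?_⟩
    rw [centralizer_singleton_conj_prod_eq hB, hx]
  · intro T hT T' hT' hconj
    obtain ⟨TA, hTA, rfl⟩ := Finset.mem_image.mp hT
    obtain ⟨TA', hTA', rfl⟩ := Finset.mem_image.mp hT'
    rw [h3 TA hTA TA' hTA' (exists_map_conj_eq_of_prod_top hconj)]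

/-- **A compact subgroup carries a Haar PROBABILITY measure** (on the subtype): Mathlib `haarMeasure ⊤`, `haarMeasure_self`. [folklore]
[cite: Folland1995, §2.2] -/
theorem exists_isHaarMeasure_isProbabilityMeasure_coe {G : Type*} [Group G] [TopologicalSpace G] [IsTopologicalGroup G]
    [MeasurableSpace G] [BorelSpace G] (T : Subgroup G) (hT : IsCompact (T : Set G)) :
    ∃ μ : Measure ↥T, μ.IsHaarMeasure ∧ IsProbabilityMeasure μ := by
  haveI : CompactSpace ↥T := isCompact_iff_compactSpace.mp hT
  refine ⟨haarMeasure (⊤ : PositiveCompacts ↥T), inferInstance, ⟨?_⟩⟩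
  rw [← PositiveCompacts.coe_top]
  exact haarMeasure_self

/-- **CARTAN-ELL-PROD, with measures — the (P5) «CARTAN-ELL-H» shape at abstract `A × B`.**  Under the hypotheses of
`exists_cartanEll_prod_of_cartanEll`, for a topological group structure on `A × B` with a Borel σ-algebra, there are `SH` AND a family
`μTHf : (T : Subgroup (A × B)) → Measure ↥T` with: every `T ∈ SH` compact, `= Z(γ₀)` with `Reg γ₀`, `μTHf T` a Haar PROBABILITY measure
(print's «meas(T) = 1»); completeness; pairwise non-conjugacy — clause for clause the hypothesis `hCartEllH` of ★ `cartanH_pins_of_cartanEllH`.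
[cite: Rogawski1990, §3.6 pp. 28–31; §12.5 p. 184] -/
theorem exists_cartanEll_prod_of_cartanEll_haar [IsTopologicalGroup (A × B)] [MeasurableSpace (A × B)] [BorelSpace (A × B)]
    [CompactSpace B] (hB : ∀ b₁ b₂ : B, b₁ * b₂ = b₂ * b₁)
    {RegA : A → Prop} {Reg : A × B → Prop} (hReg : ∀ γ : A × B, Reg γ → RegA γ.1) (hfill : ∀ a : A, RegA a → ∃ b : B, Reg (a, b))
    (hA : ∃ SA : Finset (Subgroup A),
      (∀ T ∈ SA, IsCompact (T : Set A) ∧ ∃ a₀ : A, RegA a₀ ∧ T = Subgroup.centralizer ({a₀} : Set A)) ∧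
      (∀ a₀ : A, RegA a₀ → IsCompact ((Subgroup.centralizer ({a₀} : Set A) : Subgroup A) : Set A) →
        ∃ T ∈ SA, ∃ x : A, Subgroup.centralizer ({x * a₀ * x⁻¹} : Set A) = T) ∧
      (∀ T ∈ SA, ∀ T' ∈ SA, (∃ x : A, T.map (MulAut.conj x).toMonoidHom = T') → T = T')) :
    ∃ (SH : Finset (Subgroup (A × B))) (μTHf : (T : Subgroup (A × B)) → Measure ↥T),
      (∀ T ∈ SH, IsCompact (T : Set (A × B)) ∧ (∃ γ₀ : A × B, Reg γ₀ ∧ T = Subgroup.centralizer ({γ₀} : Set (A × B))) ∧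
        (μTHf T).IsHaarMeasure ∧ IsProbabilityMeasure (μTHf T)) ∧
      (∀ γ₀ : A × B, Reg γ₀ → IsCompact ((Subgroup.centralizer ({γ₀} : Set (A × B)) : Subgroup (A × B)) : Set (A × B)) →
        ∃ T ∈ SH, ∃ z : A × B, Subgroup.centralizer ({z * γ₀ * z⁻¹} : Set (A × B)) = T) ∧
      (∀ T ∈ SH, ∀ T' ∈ SH, (∃ z : A × B, T.map (MulAut.conj z).toMonoidHom = T') → T = T') := by
  classical
  obtain ⟨SH, h1, h2, h3⟩ := exists_cartanEll_prod_of_cartanEll hB hReg hfill hA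
  refine ⟨SH, fun T => if hc : IsCompact (T : Set (A × B)) then (exists_isHaarMeasure_isProbabilityMeasure_coe T hc).choose else 0,
    fun T hT => ?_, h2, h3⟩
  obtain ⟨hc, hγ⟩ := h1 T hT
  simp only [dif_pos hc]
  exact ⟨hc, hγ, (exists_isHaarMeasure_isProbabilityMeasure_coe T hc).choose_spec⟩

/-! ## §5 NORMAL FORM: from «finitely many conjugacy classes of Cartan subgroups» (two clauses, the CARTAN-FIN road's head shape) to the three
(P5) clauses on the COMPACT ones, with pairwise non-conjugate representatives -/

/-- `g ∈ Ad(x) T ↔ x⁻¹ g x ∈ T`. [folklore] -/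
theorem mem_map_conj_iff {G : Type*} [Group G] (T : Subgroup G) (x g : G) :
    g ∈ T.map (MulAut.conj x).toMonoidHom ↔ x⁻¹ * g * x ∈ T := by
  rw [Subgroup.mem_map_equiv, MulAut.conj_symm_apply]

/-- Conjugacy of subgroups is reflexive. [folklore] -/
theorem isConjSubgroup_refl {G : Type*} [Group G] (T : Subgroup G) : ∃ x : G, T.map (MulAut.conj x).toMonoidHom = T :=
  ⟨1, by ext g; rw [mem_map_conj_iff, inv_one, one_mul, mul_one]⟩

/-- Conjugacy of subgroups is symmetric. [folklore] -/
theorem isConjSubgroup_symm {G : Type*} [Group G] {T T' : Subgroup G} (h : ∃ x : G, T.map (MulAut.conj x).toMonoidHom = T') :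
    ∃ x : G, T'.map (MulAut.conj x).toMonoidHom = T := by
  obtain ⟨x, rfl⟩ := h
  refine ⟨x⁻¹, ?_⟩
  ext g
  simp only [mem_map_conj_iff, inv_inv]
  rw [show x⁻¹ * (x * g * x⁻¹) * x = g by group]

/-- Conjugacy of subgroups is transitive. [folklore] -/
theorem isConjSubgroup_trans {G : Type*} [Group G] {T T' T'' : Subgroup G} (h : ∃ x : G, T.map (MulAut.conj x).toMonoidHom = T')
    (h' : ∃ x : G, T'.map (MulAut.conj x).toMonoidHom = T'') : ∃ x : G, T.map (MulAut.conj x).toMonoidHom = T'' := by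
  obtain ⟨x, rfl⟩ := h
  obtain ⟨y, rfl⟩ := h'
  refine ⟨y * x, ?_⟩
  ext g
  simp only [mem_map_conj_iff, mul_inv_rev]
  rw [show x⁻¹ * y⁻¹ * g * (y * x) = x⁻¹ * (y⁻¹ * g * y) * x by group]

/-- `Ad(x) T` is compact iff `T` is (conjugation is a homeomorphism). [folklore] -/
theorem isCompact_coe_map_conj_iff {G : Type*} [Group G] [TopologicalSpace G] [IsTopologicalGroup G] (T : Subgroup G) (x : G) :
    IsCompact ((T.map (MulAut.conj x).toMonoidHom : Subgroup G) : Set G) ↔ IsCompact (T : Set G) := by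
  have key : ∀ (S : Subgroup G) (y : G), IsCompact (S : Set G) → IsCompact ((S.map (MulAut.conj y).toMonoidHom : Subgroup G) : Set G) := by
    intro S y hS
    rw [Subgroup.coe_map]
    exact hS.image ((Homeomorph.mulLeft y).trans (Homeomorph.mulRight y⁻¹)).continuous
  refine ⟨fun h => ?_, key T x⟩
  have h2 := key _ x⁻¹ h
  obtain ⟨z, hz⟩ := isConjSubgroup_symm ⟨x, (rfl : T.map (MulAut.conj x).toMonoidHom = _)⟩
  -- `Ad(x⁻¹) Ad(x) T = T`
  have : (T.map (MulAut.conj x).toMonoidHom).map (MulAut.conj x⁻¹).toMonoidHom = T := by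
    ext g
    simp only [mem_map_conj_iff, inv_inv]
    rw [show x⁻¹ * (x * g * x⁻¹) * x = g by group]
  rwa [this] at h2

/-- **NORMAL FORM.**  Let `P` be any predicate on a topological group `A` (no conjugation invariance needed) and suppose the Cartan subgroups `Z(γ)`, `P γ`, fall into
FINITELY MANY `A`-conjugacy classes in the two-clause form «`∃ S` finite, every member some `Z(γ₀)` with `P γ₀`, and every `Z(γ)`, `P γ`, is `Ad(u) T` for
some `T ∈ S`» (the head shape of the CARTAN-FIN road).  Then the COMPACT ones admit a finite set of representatives in the three-clause (P5) form:
compact `Z(a₀)`'s with `P a₀`; every compact `Z(a₀)`, `P a₀`, has `Z(x a₀ x⁻¹) ∈ SA`; distinct members of `SA` are NOT conjugate (one representative per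
class, chosen by `Classical.epsilon` on the class — conjugate subgroups have the same class predicate). [cite: Rogawski1990, §3.6 pp. 28–31] -/
theorem exists_cartanEll_of_finite_classes {A : Type*} [Group A] [TopologicalSpace A] [IsTopologicalGroup A] {P : A → Prop}
    (hS : ∃ S : Finset (Subgroup A),
      (∀ T ∈ S, ∃ γ₀ : A, P γ₀ ∧ T = Subgroup.centralizer ({γ₀} : Set A)) ∧
      ∀ γ : A, P γ → ∃ T ∈ S, ∃ u : A, Subgroup.centralizer ({γ} : Set A) = T.map (MulAut.conj u).toMonoidHom) :
    ∃ SA : Finset (Subgroup A),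
      (∀ T ∈ SA, IsCompact (T : Set A) ∧ ∃ a₀ : A, P a₀ ∧ T = Subgroup.centralizer ({a₀} : Set A)) ∧
      (∀ a₀ : A, P a₀ → IsCompact ((Subgroup.centralizer ({a₀} : Set A) : Subgroup A) : Set A) →
        ∃ T ∈ SA, ∃ x : A, Subgroup.centralizer ({x * a₀ * x⁻¹} : Set A) = T) ∧
      (∀ T ∈ SA, ∀ T' ∈ SA, (∃ x : A, T.map (MulAut.conj x).toMonoidHom = T') → T = T') := by
  classical
  obtain ⟨S, h1, h2⟩ := hS
  -- the compact members and one representative per conjugacy class among them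
  set C : Finset (Subgroup A) := S.filter fun T => IsCompact (T : Set A) with hC
  let cls : Subgroup A → Subgroup A → Prop := fun T T' => T' ∈ C ∧ ∃ x : A, T.map (MulAut.conj x).toMonoidHom = T'
  let rep : Subgroup A → Subgroup A := fun T => Classical.epsilon (cls T)
  have hrep : ∀ T ∈ C, rep T ∈ C ∧ ∃ x : A, T.map (MulAut.conj x).toMonoidHom = rep T :=
    fun T hT => Classical.epsilon_spec (p := cls T) ⟨T, hT, isConjSubgroup_refl T⟩
  have hcls : ∀ T₁ T₂ : Subgroup A, (∃ x : A, T₁.map (MulAut.conj x).toMonoidHom = T₂) → rep T₁ = rep T₂ := by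
    intro T₁ T₂ h12
    have : cls T₁ = cls T₂ := by
      funext T'
      exact propext ⟨fun h => ⟨h.1, isConjSubgroup_trans (isConjSubgroup_symm h12) h.2⟩, fun h => ⟨h.1, isConjSubgroup_trans h12 h.2⟩⟩
    show Classical.epsilon (cls T₁) = Classical.epsilon (cls T₂)
    rw [this]
  have hCS : ∀ T ∈ C, IsCompact (T : Set A) ∧ T ∈ S := fun T hT => by
    rw [hC, Finset.mem_filter] at hT
    exact ⟨hT.2, hT.1⟩
  refine ⟨C.image rep, ?_, ?_, ?_⟩
  · intro T hT
    obtain ⟨T₀, hT₀, rfl⟩ := Finset.mem_image.mp hT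
    obtain ⟨hc, hs⟩ := hCS _ (hrep T₀ hT₀).1
    exact ⟨hc, h1 _ hs⟩
  · intro a₀ ha₀ hc
    obtain ⟨T, hTS, u, hu⟩ := h2 a₀ ha₀
    -- `T = Ad(u⁻¹) Z(a₀) = Z(u⁻¹ a₀ u)` is compact
    have hT : T = Subgroup.centralizer ({u⁻¹ * a₀ * u⁻¹⁻¹} : Set A) := by
      rw [centralizer_singleton_conj_eq_map, hu]
      ext g
      simp only [mem_map_conj_iff, inv_inv]
      rw [show u⁻¹ * (u * g * u⁻¹) * u = g by group]
    have hTc : IsCompact (T : Set A) := by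
      rw [hT, centralizer_singleton_conj_eq_map, isCompact_coe_map_conj_iff]
      exact hc
    have hTC : T ∈ C := by
      rw [hC, Finset.mem_filter]
      exact ⟨hTS, hTc⟩
    obtain ⟨-, y, hy⟩ := hrep T hTC
    refine ⟨rep T, Finset.mem_image.mpr ⟨T, hTC, rfl⟩, y * (u⁻¹), ?_⟩
    rw [← hy, hT, centralizer_singleton_conj_eq_map, centralizer_singleton_conj_eq_map]
    ext g
    rw [mem_map_conj_iff, mem_map_conj_iff, mem_map_conj_iff,
      show (y * u⁻¹)⁻¹ * g * (y * u⁻¹) = u⁻¹⁻¹ * (y⁻¹ * g * y) * u⁻¹ by group]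
  · intro T hT T' hT' hx
    obtain ⟨T₁, hT₁, rfl⟩ := Finset.mem_image.mp hT
    obtain ⟨T₂, hT₂, rfl⟩ := Finset.mem_image.mp hT'
    have h₁ := (hrep T₁ hT₁).2
    have h₂ := (hrep T₂ hT₂).2
    exact hcls T₁ T₂ (isConjSubgroup_trans (isConjSubgroup_trans h₁ hx) (isConjSubgroup_symm h₂))

end Topology

end Summit.HodgeConjecture.HodgeConjecture.Cruxes.H413.F0P3cStCharTSCartanEllProd

end
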